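import Literature.AlgebraicGeometry.HodgeTheory.BettiHodgeConjectureSquareAlgebraicCorrespondences
import HarnessLib

/-!
# Algebraic correspondences between two DIFFERENT factors: the Künneth component of a Hodge class acting on `Hᵃ(Z;ℂ)`, lower bounds `r ≤ dim Hom_HS` from independent actions of correspondences,
# and `HC(Y × Z)` when the Hodge classes of the pieces `Hᵐ(Y) ⊗ Hʲ(Z)` of an off-middle-algebraic factor are accounted for by algebraic correspondences; pairs of smooth hypersurfaces
# (Voisin I §11.3.3 Thm. 11.38–11.40, Lemma 11.41, pp. 286–287; Voisin II (10.7); Voisin 2025 §3.2.1; Fulton §16.1; Kahn Ex. 3.47)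

Family `hodge`, lane `lit-hodgefound` (Track 2 foundations library; Layers A1/A4), layer `Literature/AlgebraicGeometry/HodgeTheory`.  THEOREMS ONLY (no definition, no named fact, no instance;
D-0026 net debt `0`).  Sequel of the seat's g29-#11 (`BettiHodgeConjectureSquareAlgebraicCorrespondences`: on `X × X` with `X` off-middle algebraic, the middle Künneth component of an algebraic
class is algebraic and acts as the class does; `dim End_HS(HⁿX) ≤ r` independent algebraic correspondences ⇒ `HC(X × X)`) with the diagonal square replaced by a product `Y × Z` of two different
smooth projective varieties (`dim Y = m`, `dim Z = n`).  A class `γ ∈ H^{2c}(Y × Z;ℚ)` acts as a correspondence `γ_* = pr_{Y*}(pr_Z^*(–) ∪ γ ⊗ 1) : Hᵃ(Z;ℂ) → Hⁱ(Y;ℂ)` (`a + 2c = i + 2n`; the tree's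
`corrAction`, Voisin II (10.7), the FIRST factor receives), and on `Hᵃ(Z;ℂ)` only its Künneth component in `Hⁱ(Y) ⊗ Hʲ(Z)`, `j = 2n − a`, acts («`Hᵏ(X) ⊗ Hˡ(Y) ≅ Hom(H^{2n−k}(X), Hˡ(Y))`»,
Voisin I p. 286).  Two consequences are drawn.  (A) LOWER BOUNDS: `r` Hodge classes on `Y × Z` (for instance algebraic ones: graphs, correspondences) whose actions `Hᵃ(Z;ℂ) → Hⁱ(Y;ℂ)` are
ℂ-linearly independent have ℚ-linearly independent components in `Hdgᶜ(HⁱY ⊗ HʲZ)`, so `r ≤ dim_ℚ Hdgᶜ(HⁱY ⊗ HʲZ) = dim_ℚ Hom_HS(HⁱY, HʲZ(c − i))` (Lemma 11.41).  (B) `HC(Y × Z)`: when `Y` is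
OFF-MIDDLE ALGEBRAIC (`Hᵏ(Y;ℚ) = 0` for odd `k ≠ m`, `Hdgᵖ(H^{2p}Y) = H^{2p}(Y;ℚ)` for `2p ≠ m`) with `HC(Y)` and `HC(Z)` holds, the `(m, j)`-component of an ALGEBRAIC class is itself algebraic
(the other components are zero or have a pure factor, g29-#6/#7), so a piece `Hᵐ(Y) ⊗ Hʲ(Z)` whose Hodge classes are no more numerous than independent actions of algebraic correspondences on
`H^{2n−j}(Z;ℂ)` is algebraic; with g29-#7 (`…_of_offMiddle_algebraic_left/right`), `HC(Y × Z)` follows when every piece `Hᵐ(Y) ⊗ Hʲ(Z)`, `1 ≤ j ≤ n`, is so accounted for.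

WHAT IS PROVED.
* §1 **`BettiUniverse.exists_kunneth_family_corrAction_eq`** (any `Y`, `Z`, any orientation family `μ`): a Hodge class `v ∈ Hdgᶜ(H^{2c}(Y × Z))` is `Σ_{i'+j'=2c} crossMap t_{i'j'}` for Hodge
  classes `t_{i'j'}` of the Künneth summands, and for `a + 2c = i + 2n` (`i + j = 2c`) the actions on `Hᵃ(Z;ℂ)` of `v ⊗ 1` and of `crossMap t_{ij} ⊗ 1` coincide.
* §2 **`BettiUniverse.card_le_finrank_hodgeClasses_tensor_of_linearIndependent_corrAction`**: Hodge classes `v_k`, `k ∈ ι`, of `H^{2c}(Y × Z)` with ℂ-linearly independent actions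
  `Hᵃ(Z;ℂ) → Hⁱ(Y;ℂ)` ⇒ `|ι| ≤ dim_ℚ Hdgᶜ(HⁱY ⊗ HʲZ)`; Hom form **`…_le_finrank_hom_tateTwist_…`** (`≤ dim_ℚ Hom_HS(HⁱY, HʲZ(c − i))`); for ALGEBRAIC classes
  (**`…_of_mem_algebraicClasses`**); examples: **`BettiUniverse.card_le_finrank_hodgeClasses_tensor_of_linearIndependent_pullback`** (morphisms `φ_k : Y ⟶ Z` with independent pull-backs
  `φ_k^*` on `Hᵃ(Z;ℂ)`, via the transposed graphs `[ᵗΓ_{φ_k}] = (𝟙, φ_k)_* 1`, Kahn Ex. 3.47), **`BettiUniverse.two_le_finrank_end_hodge_of_endomorphism`** (`Id`, `σ^*` independent on `Hⁿ(X;ℂ)`,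
  `n = dim X` ⇒ `2 ≤ dim_ℚ End_HS(HⁿX)`).
* §3 **`BettiUniverse.exists_kunneth_algebraic_corrAction_eq_left`** / **`…_right`**: `Y` (resp. `Z`) off-middle algebraic, `HC(Y)`, `HC(Z)`, `γ ∈ H^{2c}(Y × Z;ℚ)` with algebraic
  complexification ⇒ a Hodge class `t` of the summand `Hᵐ(Y) ⊗ Hʲ(Z)` (resp. `Hⁱ(Y) ⊗ Hⁿ(Z)`) with `crossMap t ⊗ 1` ALGEBRAIC and the same action on `H^{2n−j}(Z;ℂ)` (resp. `Hⁿ(Z;ℂ)`).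
* §4 **`BettiUniverse.crossMap_mem_algebraicClasses_of_linearIndependent_corrAction_left`** / **`…_right`**: under §3's hypotheses, if `dim_ℚ Hdgᶜ(HᵐY ⊗ HʲZ) ≤ |ι|` for a family of `|ι|`
  algebraic classes with independent actions, every Hodge class of the piece has algebraic cross product (and the dimension equals `|ι|`, **`…finrank_hodgeClasses_tensor_eq_card…`**).
* §5 ASSEMBLY.  **`BettiUniverse.hodgeConjectureFor_tensor_of_offMiddle_algebraic_left_of_corrAction`** (`Y` off-middle algebraic, `HC(Y)`, `HC(Z)`, and for every piece `(m, j)`, `1 ≤ j ≤ n`,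
  `m + j = 2c`, a finite family of algebraic correspondences with independent actions on `H^{2n−j}(Z;ℂ)` of size `≥ dim_ℚ Hdgᶜ(HᵐY ⊗ HʲZ)` ⇒ `HC(Y × Z)`), the mirror **`…_right_of_corrAction`**,
  and for BOTH factors off-middle algebraic the single piece `Hᵐ(Y) ⊗ Hⁿ(Z)`: **`BettiUniverse.hodgeConjectureFor_tensor_of_offMiddle_algebraic_of_linearIndependent_corrAction`** with its
  Hom form **`…_of_finrank_hom_le`** (`dim_ℚ Hom_HS(HᵐY, HⁿZ(c − m)) ≤ |ι|`, `m + n = 2c`).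
* §6 PAIRS OF SMOOTH HYPERSURFACES `Y ⊂ ℙ^{m+1}`, `Y' ⊂ ℙ^{n+1}` (off-middle algebraic by the tree's proved Lefschetz theorems, Voisin II Cor. 1.24/1.25): `m + n = 2c`, `|ι|` algebraic
  correspondences with independent actions `Hⁿ(Y';ℂ) → Hᵐ(Y;ℂ)` and `dim_ℚ Hom_HS(HᵐY, HⁿY'(c − m)) ≤ |ι|` ⇒ `HC(Y × Y')` — **`IsSmoothHypersurface.hodgeConjectureFor_tensor_hypersurface_of_odd_of_linearIndependent_corrAction`**
  (`m`, `n` odd: unconditional modulo the correspondences) and **`…_of_hodgeConjectureFor_of_linearIndependent_corrAction`** (any parity, given `HC(Y)`, `HC(Y')`).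

THE PRINTS.  C. Voisin (2002) [VoisinHodgeI2002] §11.1.2 Prop. 11.20; §11.3.3 Thm. 11.38, Def. 11.39, Thm. 11.40, Lemma 11.41 and its proof, pp. 285–287 («`Hᵏ(X) ⊗ Hˡ(Y) ≅ Hom(H^{2n−k}(X), Hˡ(Y))` …
a Hodge class of type `(k,l)` … is a morphism of Hodge structures»).  C. Voisin (2003) [VoisinHodgeII2003] §1.2.3 Cor. 1.24–1.25; §10.2.2 proof of Thm. 10.17, (10.7) («`α_r^*(β) = pr_{1*}(pr_2^*(β) ∪ α)`»).
C. Voisin (2025) [Voisin2025] §3.2.1 (12)–(14), Prop. 3.8, Cor. 3.9.  W. Fulton (1998) [Fulton1998] §16.1 Prop. 16.1.1–16.1.2, Def. 16.1.2 (correspondences, graphs, `ᵗΓ_f`).  B. Kahn (2020) [Kahn2020]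
§3.5.3 Example 3.47 (`[ᵗΓ_f]_* = f^*`).  P. Deligne (1971) [DeligneHodgeII1971] 2.1.13–2.1.14.  P. Deligne (2000/2006) [Deligne2000] §1.

THE OBJECTS (all the tree's).  `Y Z X : SchemeOver ℂ`, `hY : IsSmoothProjective m Y`, `hZ : IsSmoothProjective n Z`, `hYZ : IsSmoothProjective d (Y ⊗ Z)`; `hHD : exists_isReal_hodgeModel`;
`Hᵏ(X) = BettiUniverse.hodge hHD hX k`, `hodgeClasses`, `HodgeStructure.Hom`, `tensor`, `tateTwist`, `cast`; `BettiUniverse.KunnethSrc`, `BettiUniverse.kunnethSummand`, `BettiUniverse.crossMap`,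
`kunnethPiece`; `corrAction μ hY hZ hab γ : Hᵃ(Z;ℂ) →ₗ Hⁱ(Y;ℂ)` (`γ ↦ γ_*`), `complexGysin`, `complexBetti.map φ a` (`φ^*`), `diagonalClass`; `bettiCohomology`, `complexBetti`, `ofRatClass`,
`IsRationalClass`, `algebraicClasses`, `HodgeConjectureFor`, `IsSmoothHypersurface`.

DEVIATIONS / SCOPE.  Linear independence of the actions and the bounds `dim_ℚ Hdg ≤ |ι|` are hypotheses: which correspondences exist is the geometry of the particular pair.  The injectivity of
`t ↦ (crossMap t ⊗ 1)_*` on a Künneth summand (Poincaré duality on `Z`) is not needed and not proved here.  No definitions.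

## References
* [VoisinHodgeI2002] C. Voisin, *Hodge Theory and Complex Algebraic Geometry I* (2002) — §11.1.2 Prop. 11.20; §11.3.3 Thm. 11.38, Def. 11.39, Thm. 11.40, Lemma 11.41, pp. 285–287.
* [VoisinHodgeII2003] C. Voisin, *Hodge Theory and Complex Algebraic Geometry II* (2003) — §1.2.3 Cor. 1.24–1.25; §10.2.2 proof of Thm. 10.17 (10.7).
* [Voisin2025] C. Voisin, *Cycle classes on algebraic varieties* (2025) — §3.2.1 (12)–(14), Prop. 3.8, Cor. 3.9.
* [Fulton1998] W. Fulton, *Intersection Theory* (2nd ed., 1998) — §16.1 Prop. 16.1.1, Prop. 16.1.2, Def. 16.1.2.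
* [Kahn2020] B. Kahn, *Zeta and L-functions of varieties and motives* (2020) — §3.5.3 Example 3.47.
* [DeligneHodgeII1971] P. Deligne, *Théorie de Hodge II*, Publ. Math. IHÉS 40 (1971) — 2.1.13–2.1.14.
* [Deligne2000] P. Deligne, *The Hodge conjecture* (Clay problem description) — §1.
* [HatcherAT2002] A. Hatcher, *Algebraic Topology* (2002) — §3.1 p. 198.

## Provenance
Lane `lit-hodgefound` (Hodge path, Track 2), prover seat `lit-hodgefound-p29` (generation 30), self-proposed row g30-#1 (gen-29 free pointer (a): g29-#11 for two different factors).
-/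

noncomputable section

open scoped TensorProduct
open CategoryTheory MonoidalCategory CartesianMonoidalCategory Module Finset
open Literature.AlgebraicTopology.SingularHomology
open Literature.Geometry.Kaehler

namespace Literature.AlgebraicGeometry.HodgeTheory

open Literature.AlgebraicGeometry.Motives
open Literature.AlgebraicGeometry.Motives.HodgeStructure

variable {m n d : ℕ} {X Y Z : SchemeOver ℂ}

/-! ### §0 Plumbing -/

/-- `(q • a) ⊗ 1 = q • (a ⊗ 1)` for the lattice map `Hᵏ(Y;ℚ) → Hᵏ(Y;ℂ)` (private copy of the tree's file-local lemma). [cite: HatcherAT2002, §3.1 p. 198] -/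
private theorem ofRatClass_rat_smul' {T : Type} [TopologicalSpace T] {k : ℕ} (q : ℚ) (a : singularCohomology ℚ ℚ T k) :
    ofRatClass T k (q • a) = (q : ℂ) • ofRatClass T k a := by
  rw [ofRatClass, coeffClass_smul, smul_coeffClass]
  refine coeffClass_congr (fun x ↦ ?_) a
  simp

/-! ### §1 The Künneth family of a Hodge class: on `Hᵃ(Z;ℂ)` only the member of `Z`-degree `2n − a` acts -/

section Family

variable [HodgeTensorFacts.{0, 0}]

/-- **The Künneth family of a Hodge class and its action as a correspondence.**  Let `v ∈ Hdgᶜ(H^{2c}(Y × Z))` (`dim Y = m`, `dim Z = n`, any smooth-projective witness of the product).  Then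
`v = Σ_{i'+j'=2c} crossMap t_{i'j'}` for Hodge classes `t_{i'j'}` of the Künneth summands `H^{i'}(Y) ⊗ H^{j'}(Z)` (Thm. 11.38/11.40), and for `i + j = 2c`, `a + 2c = i + 2n` (so `a + j = 2n`) the
correspondence actions `Hᵃ(Z;ℂ) → Hⁱ(Y;ℂ)` of `v ⊗ 1` and of `crossMap t_{ij} ⊗ 1` coincide: a piece `H^{i'}(Y) ⊗ H^{j'}(Z)` with `j' ≠ 2n − a` acts by zero on `Hᵃ(Z;ℂ)`
(«`Hᵏ(X) ⊗ Hˡ(Y) ≅ Hom(H^{2n−k}(X), Hˡ(Y))`»), for every orientation family `μ`. [cite: VoisinHodgeI2002, §11.3.3 Thm. 11.38, Thm. 11.40 and p. 286] [cite: Voisin2025, §3.2.1 (12)–(14)]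
[cite: VoisinHodgeII2003, §10.2.2 proof of Thm. 10.17 (10.7)] -/
theorem BettiUniverse.exists_kunneth_family_corrAction_eq (μ : OrientationFamily) (hHD : exists_isReal_hodgeModel) (hY : IsSmoothProjective m Y) (hZ : IsSmoothProjective n Z)
    (hYZ : IsSmoothProjective d (Y ⊗ Z)) {c i j a : ℕ} (hij : i + j = 2 * c) (hab : a + 2 * c = i + 2 * n) {v : bettiCohomology (Y ⊗ Z) (2 * c)}
    (hv : v ∈ (BettiUniverse.hodge hHD hYZ (2 * c)).hodgeClasses c) :
    ∃ t : BettiUniverse.KunnethSrc Y Z (2 * c), (∀ ij, t ij ∈ (BettiUniverse.kunnethSummand hHD hY hZ (2 * c) ij).hodgeClasses c) ∧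
      v = ∑ ij : ↥(antidiagonal (2 * c)), BettiUniverse.crossMap Y Z (mem_antidiagonal.1 ij.2) (t ij) ∧
      corrAction μ hY hZ hab (ofRatClass (ComplexPoints (Y ⊗ Z)) (2 * c) (BettiUniverse.crossMap Y Z hij (t ⟨(i, j), HasAntidiagonal.mem_antidiagonal.2 hij⟩))) =
        corrAction μ hY hZ hab (ofRatClass (ComplexPoints (Y ⊗ Z)) (2 * c) v) := by
  classical
  obtain ⟨t, ⟨ht, hsum⟩, -⟩ := BettiUniverse.exists_eq_kunnethMap_of_mem_hodgeClasses hHD hodgePQ_independent_of_hodgeModel_holds hY hZ hYZ (2 * c) c hv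
  refine ⟨t, ht, hsum, ?_⟩
  set inn : ↥(antidiagonal (2 * c)) := ⟨(i, j), HasAntidiagonal.mem_antidiagonal.2 hij⟩ with hinn
  have hsplit : ofRatClass (ComplexPoints (Y ⊗ Z)) (2 * c) v =
      ofRatClass (ComplexPoints (Y ⊗ Z)) (2 * c) (BettiUniverse.crossMap Y Z (mem_antidiagonal.1 inn.2) (t inn)) +
        ∑ ij ∈ univ.erase inn, ofRatClass (ComplexPoints (Y ⊗ Z)) (2 * c) (BettiUniverse.crossMap Y Z (mem_antidiagonal.1 ij.2) (t ij)) := by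
    rw [hsum, map_sum, ← Finset.add_sum_erase univ _ (Finset.mem_univ inn)]
  have hothers : ∀ ij ∈ univ.erase inn, ij.1.2 ≠ j := by
    intro ij hij' h
    have hne : ij ≠ inn := (Finset.mem_erase.1 hij').1
    have hsum' : ij.1.1 + ij.1.2 = 2 * c := mem_antidiagonal.1 ij.2
    exact hne (Subtype.ext (Prod.ext (show ij.1.1 = i by omega) h))
  rw [hsplit, map_add, map_sum, Finset.sum_eq_zero fun ij hij' ↦ ?_, add_zero]
  obtain ⟨⟨i', j'⟩, hij2⟩ := ij
  have hj : j' ≠ j := hothers _ hij'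
  have hij2' : i' + j' = 2 * c := mem_antidiagonal.1 hij2
  exact corrAction_eq_zero_of_mem_kunnethPiece_of_ne μ hY hZ (e := c) (i := j') (j := i') hij2' (ofRatClass_crossMap_mem_kunnethPiece hij2' (t ⟨(i', j'), hij2⟩)) hab
    (show a + j' ≠ 2 * n by omega)

/-- **Corollary: the `(i, j)`-component acting as the class.**  For `v ∈ Hdgᶜ(H^{2c}(Y × Z))` and `a + 2c = i + 2n` there is a Hodge class `t ∈ Hdgᶜ(HⁱY ⊗ HʲZ)` with `(crossMap t ⊗ 1)_* = (v ⊗ 1)_*` on `Hᵃ(Z;ℂ)`.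
[cite: VoisinHodgeI2002, §11.3.3 Thm. 11.38, Thm. 11.40 and p. 286] [cite: Voisin2025, §3.2.1 (12)–(14)] -/
theorem BettiUniverse.exists_kunneth_component_corrAction_eq (μ : OrientationFamily) (hHD : exists_isReal_hodgeModel) (hY : IsSmoothProjective m Y) (hZ : IsSmoothProjective n Z)
    (hYZ : IsSmoothProjective d (Y ⊗ Z)) {c i j a : ℕ} (hij : i + j = 2 * c) (hab : a + 2 * c = i + 2 * n) {v : bettiCohomology (Y ⊗ Z) (2 * c)}
    (hv : v ∈ (BettiUniverse.hodge hHD hYZ (2 * c)).hodgeClasses c) :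
    ∃ t ∈ (BettiUniverse.kunnethSummand hHD hY hZ (2 * c) ⟨(i, j), HasAntidiagonal.mem_antidiagonal.2 hij⟩).hodgeClasses c,
      corrAction μ hY hZ hab (ofRatClass (ComplexPoints (Y ⊗ Z)) (2 * c) (BettiUniverse.crossMap Y Z hij t)) = corrAction μ hY hZ hab (ofRatClass (ComplexPoints (Y ⊗ Z)) (2 * c) v) := by
  obtain ⟨t, ht, -, hact⟩ := BettiUniverse.exists_kunneth_family_corrAction_eq μ hHD hY hZ hYZ hij hab hv
  exact ⟨t _, ht _, hact⟩

end Family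

/-! ### §2 Lower bounds: independent actions of Hodge classes on `Y × Z` give independent Hodge classes of `Hⁱ(Y) ⊗ Hʲ(Z)` -/

section LowerBounds

variable [HodgeTensorFacts.{0, 0}]

/-- **`|ι| ≤ dim_ℚ Hdgᶜ(Hⁱ(Y) ⊗ Hʲ(Z))` from `|ι|` Hodge classes on `Y × Z` acting independently.**  Let `v_k ∈ Hdgᶜ(H^{2c}(Y × Z))`, `k ∈ ι`, have ℂ-LINEARLY INDEPENDENT correspondence actions
`(v_k ⊗ 1)_* : Hᵃ(Z;ℂ) → Hⁱ(Y;ℂ)` (`a + 2c = i + 2n`, `i + j = 2c`).  Then their `(i, j)`-Künneth components are ℚ-linearly independent Hodge classes of `Hⁱ(Y) ⊗ Hʲ(Z)` (they act as the `v_k`,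
§1), whence `|ι| ≤ dim_ℚ Hdgᶜ(HⁱY ⊗ HʲZ)`. [cite: VoisinHodgeI2002, §11.3.3 Thm. 11.38, Thm. 11.40, Lemma 11.41 and pp. 286–287] [cite: Voisin2025, §3.2.1 (12)–(14)] -/
theorem BettiUniverse.card_le_finrank_hodgeClasses_tensor_of_linearIndependent_corrAction {ι : Type} [Fintype ι] (μ : OrientationFamily) (hHD : exists_isReal_hodgeModel)
    (hY : IsSmoothProjective m Y) (hZ : IsSmoothProjective n Z) (hYZ : IsSmoothProjective d (Y ⊗ Z)) {c i j a : ℕ} (hij : i + j = 2 * c) (hab : a + 2 * c = i + 2 * n)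
    (v : ι → bettiCohomology (Y ⊗ Z) (2 * c)) (hv : ∀ k, v k ∈ (BettiUniverse.hodge hHD hYZ (2 * c)).hodgeClasses c)
    (hind : LinearIndependent ℂ fun k ↦ corrAction μ hY hZ hab (ofRatClass (ComplexPoints (Y ⊗ Z)) (2 * c) (v k))) :
    Fintype.card ι ≤ Module.finrank ℚ ↥(((BettiUniverse.hodge hHD hY i).tensor (BettiUniverse.hodge hHD hZ j)).hodgeClasses c) := by
  classical
  haveI := BettiUniverse.finite hY i
  haveI := BettiUniverse.finite hZ j
  choose t ht hact using fun k ↦ BettiUniverse.exists_kunneth_component_corrAction_eq μ hHD hY hZ hYZ hij hab (hv k)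
  have hli : LinearIndependent ℚ t := by
    rw [Fintype.linearIndependent_iff]
    intro g hg k
    have h0 := congrArg (fun s ↦ corrAction μ hY hZ hab (ofRatClass (ComplexPoints (Y ⊗ Z)) (2 * c) (BettiUniverse.crossMap Y Z hij s))) hg
    simp only [map_sum, map_smul, ofRatClass_rat_smul', map_zero] at h0
    simp_rw [hact] at h0
    have h1 := (Fintype.linearIndependent_iff.1 hind) (fun k ↦ ((g k : ℚ) : ℂ)) h0 k
    exact_mod_cast h1
  have ht' : ∀ k, t k ∈ ((BettiUniverse.hodge hHD hY i).tensor (BettiUniverse.hodge hHD hZ j)).hodgeClasses (c : ℤ) := fun k ↦ ht k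
  have hTle : Submodule.span ℚ (Set.range t) ≤ ((BettiUniverse.hodge hHD hY i).tensor (BettiUniverse.hodge hHD hZ j)).hodgeClasses (c : ℤ) :=
    Submodule.span_le.2 (Set.range_subset_iff.2 ht')
  rw [← finrank_span_eq_card hli]
  exact Submodule.finrank_mono hTle

/-- **Hom form: `|ι| ≤ dim_ℚ Hom_HS(Hⁱ(Y), Hʲ(Z)(c − i))`** (Lemma 11.41: `Hdgᶜ(HⁱY ⊗ HʲZ) ≅ Hom_HS(HⁱY, HʲZ(c − i))` by a polarization of `Hⁱ(Y)`).
[cite: VoisinHodgeI2002, §11.3.3 Thm. 11.40, Lemma 11.41 and pp. 286–287] -/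
theorem BettiUniverse.card_le_finrank_hom_tateTwist_of_linearIndependent_corrAction {ι : Type} [Fintype ι] (μ : OrientationFamily) (hHD : exists_isReal_hodgeModel)
    (hY : IsSmoothProjective m Y) (hZ : IsSmoothProjective n Z) (hYZ : IsSmoothProjective d (Y ⊗ Z)) {c i j a : ℕ} (hij : i + j = 2 * c) (hab : a + 2 * c = i + 2 * n) (hs : (j : ℤ) - 2 * ((c : ℤ) - i) = i)
    (v : ι → bettiCohomology (Y ⊗ Z) (2 * c)) (hv : ∀ k, v k ∈ (BettiUniverse.hodge hHD hYZ (2 * c)).hodgeClasses c)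
    (hind : LinearIndependent ℂ fun k ↦ corrAction μ hY hZ hab (ofRatClass (ComplexPoints (Y ⊗ Z)) (2 * c) (v k))) :
    Fintype.card ι ≤ Module.finrank ℚ (HodgeStructure.Hom (BettiUniverse.hodge hHD hY i) (((BettiUniverse.hodge hHD hZ j).tateTwist ((c : ℤ) - i)).cast hs)) := by
  have e := BettiUniverse.finrank_hodgeClasses_tensor_hodge_eq_finrank_hom_tateTwist hHD hY hZ i j (s := (c : ℤ) - i) hs
  rw [show ((i : ℕ) : ℤ) + ((c : ℤ) - i) = (c : ℤ) by ring] at e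
  rw [← e]
  exact BettiUniverse.card_le_finrank_hodgeClasses_tensor_of_linearIndependent_corrAction μ hHD hY hZ hYZ hij hab v hv hind

omit [HodgeTensorFacts.{0, 0}] in
/-- A rational class with algebraic complexification is a Hodge class of `H^{2c}(Y × Z)` (Prop. 11.20, for the product's own smooth-projective witness). [cite: VoisinHodgeI2002, §11.1.2 Prop. 11.20] -/
theorem BettiUniverse.mem_hodgeClasses_hodge_tensor_of_mem_algebraicClasses (hHD : exists_isReal_hodgeModel) (hY : IsSmoothProjective m Y) (hZ : IsSmoothProjective n Z) {c : ℕ}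
    {γ : bettiCohomology (Y ⊗ Z) (2 * c)} (hγ : ofRatClass (ComplexPoints (Y ⊗ Z)) (2 * c) γ ∈ algebraicClasses (Y ⊗ Z) c) :
    γ ∈ (BettiUniverse.hodge hHD (hY.tensor_holds hZ) (2 * c)).hodgeClasses c :=
  (BettiUniverse.mem_hodgeClasses_hodge_iff_isOfHodgeType hHD (hY.tensor_holds hZ) c γ).2 (isOfHodgeType_of_mem_algebraicClasses_of_isSmoothProjective (hY.tensor_holds hZ) c hγ)

/-- **ALGEBRAIC correspondences acting independently: `|ι| ≤ dim_ℚ Hdgᶜ(Hⁱ(Y) ⊗ Hʲ(Z))`** (rational classes `γ_k` of `H^{2c}(Y × Z)` with algebraic complexifications are Hodge classes, Prop. 11.20).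
[cite: VoisinHodgeI2002, §11.1.2 Prop. 11.20, §11.3.3 Lemma 11.41 and pp. 286–287] [cite: Fulton1998, §16.1 Def. 16.1.2] -/
theorem BettiUniverse.card_le_finrank_hodgeClasses_tensor_of_linearIndependent_corrAction_of_mem_algebraicClasses {ι : Type} [Fintype ι] (μ : OrientationFamily)
    (hHD : exists_isReal_hodgeModel) (hY : IsSmoothProjective m Y) (hZ : IsSmoothProjective n Z) {c i j a : ℕ} (hij : i + j = 2 * c) (hab : a + 2 * c = i + 2 * n)
    (γ : ι → bettiCohomology (Y ⊗ Z) (2 * c)) (hγ : ∀ k, ofRatClass (ComplexPoints (Y ⊗ Z)) (2 * c) (γ k) ∈ algebraicClasses (Y ⊗ Z) c)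
    (hind : LinearIndependent ℂ fun k ↦ corrAction μ hY hZ hab (ofRatClass (ComplexPoints (Y ⊗ Z)) (2 * c) (γ k))) :
    Fintype.card ι ≤ Module.finrank ℚ ↥(((BettiUniverse.hodge hHD hY i).tensor (BettiUniverse.hodge hHD hZ j)).hodgeClasses c) :=
  BettiUniverse.card_le_finrank_hodgeClasses_tensor_of_linearIndependent_corrAction μ hHD hY hZ (hY.tensor_holds hZ) hij hab γ
    (fun k ↦ BettiUniverse.mem_hodgeClasses_hodge_tensor_of_mem_algebraicClasses hHD hY hZ (hγ k)) hind

/-- **Morphisms with independent pull-backs.**  Let `φ_k : Y ⟶ Z`, `k ∈ ι`, have ℂ-linearly independent pull-backs `φ_k^* : Hᵃ(Z;ℂ) → Hᵃ(Y;ℂ)` (`a ≤ 2n`).  Then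
`|ι| ≤ dim_ℚ Hdgⁿ(Hᵃ(Y) ⊗ H^{2n−a}(Z))`: the transposed graph classes `[ᵗΓ_{φ_k}] = (𝟙, φ_k)_* 1 ∈ H^{2n}(Y × Z)` are rational and algebraic and act as `φ_k^*` (Kahn Ex. 3.47, the tree's
`corrAction_transposeGraph_one`). [cite: Kahn2020, §3.5.3 Example 3.47] [cite: Fulton1998, §16.1 Prop. 16.1.2 and Def. 16.1.2] [cite: VoisinHodgeI2002, §11.3.3 Lemma 11.41 and pp. 286–287] -/
theorem BettiUniverse.card_le_finrank_hodgeClasses_tensor_of_linearIndependent_pullback {ι : Type} [Fintype ι] (hHD : exists_isReal_hodgeModel) (hY : IsSmoothProjective m Y)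
    (hZ : IsSmoothProjective n Z) {a j : ℕ} (haj : a + j = 2 * n) (φ : ι → (Y ⟶ Z)) (hind : LinearIndependent ℂ fun k ↦ (complexBetti.map (φ k) a).hom) :
    Fintype.card ι ≤ Module.finrank ℚ ↥(((BettiUniverse.hodge hHD hY a).tensor (BettiUniverse.hodge hHD hZ j)).hodgeClasses n) := by
  -- rational lifts of the transposed graph classes
  have hrat : ∀ k, ∃ γ : bettiCohomology (Y ⊗ Z) (2 * n), ofRatClass (ComplexPoints (Y ⊗ Z)) (2 * n) γ =
      complexGysin complexOrientationFamily hY (hY.tensor_holds hZ) (lift (𝟙 Y) (φ k)) (show 0 + 2 * (m + n) = 2 * n + 2 * m by omega) (singularCohomology.one ℂ (ComplexPoints Y)) := by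
    intro k
    obtain ⟨γ, hγ⟩ := (isRationalClass_iff_mem_range_ofRatClass _).1
      (isRationalClass_complexGysin_complexOrientationFamily hY (hY.tensor_holds hZ) (lift (𝟙 Y) (φ k)) (show 0 + 2 * (m + n) = 2 * n + 2 * m by omega) (isRationalClass_one _))
    exact ⟨γ, hγ⟩
  choose γ hγ using hrat
  refine BettiUniverse.card_le_finrank_hodgeClasses_tensor_of_linearIndependent_corrAction_of_mem_algebraicClasses complexOrientationFamily hHD hY hZ haj (show a + 2 * n = a + 2 * n from rfl) γ
    (fun k ↦ ?_) ?_
  · rw [hγ]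
    exact complexGysin_graph_one_mem_algebraicClasses complexOrientationFamily hasPoincareDuality_complexOrientationFamily hY (hY.tensor_holds hZ) (φ k)
  · have e : (fun k ↦ corrAction complexOrientationFamily hY hZ (show a + 2 * n = a + 2 * n from rfl) (ofRatClass (ComplexPoints (Y ⊗ Z)) (2 * n) (γ k))) =
        fun k ↦ (complexBetti.map (φ k) a).hom := by
      funext k
      rw [hγ]
      exact corrAction_transposeGraph_one complexOrientationFamily hZ hY (φ k) rfl
    rw [e]
    exact hind

/-- **An endomorphism that is not a scalar on `Hⁿ(X;ℂ)`, `n = dim X`, forces `2 ≤ dim_ℚ End_HS(HⁿX)`**: the classes `[Δ]` and `[ᵗΓ_σ]` act on `Hⁿ(X;ℂ)` as `Id` and `σ^*`; if these are linearly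
independent, their middle Künneth components are two independent Hodge classes of `Hⁿ(X) ⊗ Hⁿ(X)`, and `dim_ℚ Hdgⁿ(HⁿX ⊗ HⁿX) = dim_ℚ End_HS(HⁿX)` (Lemma 11.41). [cite: VoisinHodgeI2002, §11.3.3 Lemma 11.41 and pp. 286–287]
[cite: Kahn2020, §3.5.3 Example 3.47] [cite: Fulton1998, §16.1 Def. 16.1.2] -/
theorem BettiUniverse.two_le_finrank_end_hodge_of_endomorphism (hHD : exists_isReal_hodgeModel) (hX : IsSmoothProjective n X) (σ : X ⟶ X)
    (hind : LinearIndependent ℂ ![(LinearMap.id : complexBetti X n →ₗ[ℂ] complexBetti X n), (complexBetti.map σ n).hom]) :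
    2 ≤ Module.finrank ℚ (HodgeStructure.Hom (BettiUniverse.hodge hHD hX n) (BettiUniverse.hodge hHD hX n)) := by
  rw [← BettiUniverse.finrank_hodgeClasses_tensor_hodge_eq_finrank_hom hHD hX hX n]
  have h := BettiUniverse.card_le_finrank_hodgeClasses_tensor_of_linearIndependent_pullback (ι := Fin 2) hHD hX hX (two_mul n).symm ![𝟙 X, σ] ?_
  · simpa using h
  · have e : (fun k : Fin 2 ↦ (complexBetti.map (![𝟙 X, σ] k) n).hom) = ![(LinearMap.id : complexBetti X n →ₗ[ℂ] complexBetti X n), (complexBetti.map σ n).hom] := by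
      funext k
      fin_cases k
      · simp [complexBetti.map_id]
      · simp
    rw [e]
    exact hind

/-- **A family of endomorphisms with independent pull-backs on `Hⁿ(X;ℂ)`** (`n = dim X`): `|ι| ≤ dim_ℚ End_HS(HⁿX)`. [cite: VoisinHodgeI2002, §11.3.3 Lemma 11.41 and pp. 286–287] [cite: Kahn2020, §3.5.3 Example 3.47] -/
theorem BettiUniverse.card_le_finrank_end_hodge_of_linearIndependent_pullback {ι : Type} [Fintype ι] (hHD : exists_isReal_hodgeModel) (hX : IsSmoothProjective n X) (σ : ι → (X ⟶ X))
    (hind : LinearIndependent ℂ fun k ↦ (complexBetti.map (σ k) n).hom) :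
    Fintype.card ι ≤ Module.finrank ℚ (HodgeStructure.Hom (BettiUniverse.hodge hHD hX n) (BettiUniverse.hodge hHD hX n)) := by
  rw [← BettiUniverse.finrank_hodgeClasses_tensor_hodge_eq_finrank_hom hHD hX hX n]
  exact BettiUniverse.card_le_finrank_hodgeClasses_tensor_of_linearIndependent_pullback hHD hX hX (two_mul n).symm σ hind

end LowerBounds

/-! ### §3 One off-middle-algebraic factor: the component of an algebraic class is algebraic -/

section Component

variable [HodgeTensorFacts.{0, 0}]

/-- **Left factor off-middle algebraic.**  Let `Y` (dimension `m`) satisfy `HC(Y)`, `Hᵏ(Y;ℚ) = 0` for odd `k ≠ m`, `Hdgᵖ(H^{2p}Y) = H^{2p}(Y;ℚ)` for `2p ≠ m`; let `Z` (dimension `n`) satisfy `HC(Z)`; let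
`γ ∈ H^{2c}(Y × Z;ℚ)` have ALGEBRAIC complexification, `m + j = 2c`, `a + 2c = m + 2n`.  Then there is a Hodge class `t` of the summand `Hᵐ(Y) ⊗ Hʲ(Z)` with `crossMap t ⊗ 1` ALGEBRAIC and
`(crossMap t ⊗ 1)_* = (γ ⊗ 1)_*` on `Hᵃ(Z;ℂ)`: `γ ⊗ 1` is a Hodge class (Prop. 11.20); its components in the pieces `H^{i'}(Y) ⊗ H^{j'}(Z)`, `i' ≠ m`, are zero (`i'` odd) or have the pure factor
`H^{i'}(Y)` of algebraic classes, hence algebraic cross products (g29-#6 §1), and they act by zero on `Hᵃ(Z;ℂ)` (§1). [cite: VoisinHodgeI2002, §11.1.2 Prop. 11.20, §11.3.3 Thm. 11.38–11.40, Lemma 11.41 and pp. 286–287]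
[cite: Voisin2025, §3.2.1 (12)–(14)] [cite: DeligneHodgeII1971, 2.1.13] -/
theorem BettiUniverse.exists_kunneth_algebraic_corrAction_eq_left (μ : OrientationFamily) (hHD : exists_isReal_hodgeModel) (hY : IsSmoothProjective m Y) (hZ : IsSmoothProjective n Z)
    (hHCY : HodgeConjectureFor m Y) (hHCZ : HodgeConjectureFor n Z) (hodd : ∀ k, Odd k → k ≠ m → Module.finrank ℚ (bettiCohomology Y k) = 0)
    (heven : ∀ p, 2 * p ≠ m → (BettiUniverse.hodge hHD hY (2 * p)).hodgeClasses p = ⊤) {c j a : ℕ} (hmj : m + j = 2 * c) (hab : a + 2 * c = m + 2 * n)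
    {γ : bettiCohomology (Y ⊗ Z) (2 * c)} (hγ : ofRatClass (ComplexPoints (Y ⊗ Z)) (2 * c) γ ∈ algebraicClasses (Y ⊗ Z) c) :
    ∃ t ∈ (BettiUniverse.kunnethSummand hHD hY hZ (2 * c) ⟨(m, j), HasAntidiagonal.mem_antidiagonal.2 hmj⟩).hodgeClasses c,
      ofRatClass (ComplexPoints (Y ⊗ Z)) (2 * c) (BettiUniverse.crossMap Y Z hmj t) ∈ algebraicClasses (Y ⊗ Z) c ∧
      corrAction μ hY hZ hab (ofRatClass (ComplexPoints (Y ⊗ Z)) (2 * c) (BettiUniverse.crossMap Y Z hmj t)) = corrAction μ hY hZ hab (ofRatClass (ComplexPoints (Y ⊗ Z)) (2 * c) γ) := by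
  classical
  have halgY : ∀ (p : ℕ), ∀ z ∈ (BettiUniverse.hodge hHD hY (2 * p)).hodgeClasses (p : ℤ), ofRatClass (ComplexPoints Y) (2 * p) z ∈ algebraicClasses Y p :=
    fun p z hz ↦ hHCY.2 p _ (isRationalClass_ofRatClass _) ((BettiUniverse.mem_hodgeClasses_hodge_iff_isOfHodgeType hHD hY p z).1 hz)
  have halgZ : ∀ (p : ℕ), ∀ z ∈ (BettiUniverse.hodge hHD hZ (2 * p)).hodgeClasses (p : ℤ), ofRatClass (ComplexPoints Z) (2 * p) z ∈ algebraicClasses Z p :=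
    fun p z hz ↦ hHCZ.2 p _ (isRationalClass_ofRatClass _) ((BettiUniverse.mem_hodgeClasses_hodge_iff_isOfHodgeType hHD hZ p z).1 hz)
  -- the Künneth pieces of `Y`-degree `≠ m` have algebraic Hodge classes
  have hpiece : ∀ (i' j' : ℕ) (hij' : i' + j' = 2 * c), i' ≠ m →
      ∀ u ∈ (BettiUniverse.kunnethSummand hHD hY hZ (2 * c) ⟨(i', j'), HasAntidiagonal.mem_antidiagonal.2 hij'⟩).hodgeClasses c,
        ofRatClass (ComplexPoints (Y ⊗ Z)) (2 * c) (BettiUniverse.crossMap Y Z hij' u) ∈ algebraicClasses (Y ⊗ Z) c := by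
    intro i' j' hij' him u hu
    rcases Nat.even_or_odd i' with ⟨a', ha'⟩ | hi
    · obtain ⟨a', rfl⟩ : ∃ a'', i' = 2 * a'' := ⟨a', by omega⟩
      obtain ⟨b', rfl⟩ : ∃ b', j' = 2 * b' := ⟨j' / 2, by omega⟩
      exact BettiUniverse.ofRatClass_crossMap_mem_algebraicClasses_of_hodgeClasses_eq_top_left hHD hY hZ hij' (heven a' him)
        (fun z ↦ halgY a' z (by rw [heven a' him]; exact Submodule.mem_top)) (halgZ b') hu
    · exact BettiUniverse.ofRatClass_crossMap_mem_algebraicClasses_of_finrank_eq_zero hY hZ hij' (Or.inl (hodd i' hi him)) u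
  obtain ⟨t, ht, hsum, hact⟩ := BettiUniverse.exists_kunneth_family_corrAction_eq μ hHD hY hZ (hY.tensor_holds hZ) hmj hab
    (BettiUniverse.mem_hodgeClasses_hodge_tensor_of_mem_algebraicClasses hHD hY hZ hγ)
  set inn : ↥(antidiagonal (2 * c)) := ⟨(m, j), HasAntidiagonal.mem_antidiagonal.2 hmj⟩ with hinn
  have hothers : ∀ ij ∈ univ.erase inn, ij.1.1 ≠ m := by
    intro ij hij' h
    have hne : ij ≠ inn := (Finset.mem_erase.1 hij').1
    have hsum' : ij.1.1 + ij.1.2 = 2 * c := mem_antidiagonal.1 ij.2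
    exact hne (Subtype.ext (Prod.ext h (show ij.1.2 = j by omega)))
  refine ⟨t inn, ht inn, ?_, hact⟩
  have e : ofRatClass (ComplexPoints (Y ⊗ Z)) (2 * c) (BettiUniverse.crossMap Y Z hmj (t inn)) =
      ofRatClass (ComplexPoints (Y ⊗ Z)) (2 * c) γ - ∑ ij ∈ univ.erase inn, ofRatClass (ComplexPoints (Y ⊗ Z)) (2 * c) (BettiUniverse.crossMap Y Z (mem_antidiagonal.1 ij.2) (t ij)) := by
    rw [hsum, map_sum, ← Finset.add_sum_erase univ _ (Finset.mem_univ inn), add_sub_cancel_right]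
  rw [e]
  refine Submodule.sub_mem _ hγ (Submodule.sum_mem _ fun ij hij' ↦ ?_)
  obtain ⟨⟨i', j'⟩, hij2⟩ := ij
  exact hpiece i' j' (mem_antidiagonal.1 hij2) (hothers _ hij') (t ⟨(i', j'), hij2⟩) (ht ⟨(i', j'), hij2⟩)

/-- **Right factor off-middle algebraic** (mirror): `Z` (dimension `n`) with `HC(Z)`, `Hᵏ(Z;ℚ) = 0` for odd `k ≠ n`, `Hdgᵖ(H^{2p}Z) = H^{2p}(Z;ℚ)` for `2p ≠ n`; `Y` with `HC(Y)`; `γ ∈ H^{2c}(Y × Z;ℚ)`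
with algebraic complexification, `i + n = 2c` ⇒ a Hodge class `t` of `Hⁱ(Y) ⊗ Hⁿ(Z)` with `crossMap t ⊗ 1` ALGEBRAIC and the same action on `Hⁿ(Z;ℂ)`. [cite: VoisinHodgeI2002, §11.1.2 Prop. 11.20, §11.3.3 Thm. 11.38–11.40, Lemma 11.41 and pp. 286–287]
[cite: Voisin2025, §3.2.1 (12)–(14)] [cite: DeligneHodgeII1971, 2.1.13] -/
theorem BettiUniverse.exists_kunneth_algebraic_corrAction_eq_right (μ : OrientationFamily) (hHD : exists_isReal_hodgeModel) (hY : IsSmoothProjective m Y) (hZ : IsSmoothProjective n Z)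
    (hHCY : HodgeConjectureFor m Y) (hHCZ : HodgeConjectureFor n Z) (hodd : ∀ k, Odd k → k ≠ n → Module.finrank ℚ (bettiCohomology Z k) = 0)
    (heven : ∀ p, 2 * p ≠ n → (BettiUniverse.hodge hHD hZ (2 * p)).hodgeClasses p = ⊤) {c i : ℕ} (hin : i + n = 2 * c) (hab : n + 2 * c = i + 2 * n)
    {γ : bettiCohomology (Y ⊗ Z) (2 * c)} (hγ : ofRatClass (ComplexPoints (Y ⊗ Z)) (2 * c) γ ∈ algebraicClasses (Y ⊗ Z) c) :
    ∃ t ∈ (BettiUniverse.kunnethSummand hHD hY hZ (2 * c) ⟨(i, n), HasAntidiagonal.mem_antidiagonal.2 hin⟩).hodgeClasses c,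
      ofRatClass (ComplexPoints (Y ⊗ Z)) (2 * c) (BettiUniverse.crossMap Y Z hin t) ∈ algebraicClasses (Y ⊗ Z) c ∧
      corrAction μ hY hZ hab (ofRatClass (ComplexPoints (Y ⊗ Z)) (2 * c) (BettiUniverse.crossMap Y Z hin t)) = corrAction μ hY hZ hab (ofRatClass (ComplexPoints (Y ⊗ Z)) (2 * c) γ) := by
  classical
  have halgY : ∀ (p : ℕ), ∀ z ∈ (BettiUniverse.hodge hHD hY (2 * p)).hodgeClasses (p : ℤ), ofRatClass (ComplexPoints Y) (2 * p) z ∈ algebraicClasses Y p :=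
    fun p z hz ↦ hHCY.2 p _ (isRationalClass_ofRatClass _) ((BettiUniverse.mem_hodgeClasses_hodge_iff_isOfHodgeType hHD hY p z).1 hz)
  have halgZ : ∀ (p : ℕ), ∀ z ∈ (BettiUniverse.hodge hHD hZ (2 * p)).hodgeClasses (p : ℤ), ofRatClass (ComplexPoints Z) (2 * p) z ∈ algebraicClasses Z p :=
    fun p z hz ↦ hHCZ.2 p _ (isRationalClass_ofRatClass _) ((BettiUniverse.mem_hodgeClasses_hodge_iff_isOfHodgeType hHD hZ p z).1 hz)
  -- the Künneth pieces of `Z`-degree `≠ n` have algebraic Hodge classes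
  have hpiece : ∀ (i' j' : ℕ) (hij' : i' + j' = 2 * c), j' ≠ n →
      ∀ u ∈ (BettiUniverse.kunnethSummand hHD hY hZ (2 * c) ⟨(i', j'), HasAntidiagonal.mem_antidiagonal.2 hij'⟩).hodgeClasses c,
        ofRatClass (ComplexPoints (Y ⊗ Z)) (2 * c) (BettiUniverse.crossMap Y Z hij' u) ∈ algebraicClasses (Y ⊗ Z) c := by
    intro i' j' hij' hjn u hu
    rcases Nat.even_or_odd j' with ⟨b', hb'⟩ | hj
    · obtain ⟨b', rfl⟩ : ∃ b'', j' = 2 * b'' := ⟨b', by omega⟩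
      obtain ⟨a', rfl⟩ : ∃ a', i' = 2 * a' := ⟨i' / 2, by omega⟩
      exact BettiUniverse.ofRatClass_crossMap_mem_algebraicClasses_of_hodgeClasses_eq_top_right hHD hY hZ hij' (heven b' hjn) (halgY a')
        (fun z ↦ halgZ b' z (by rw [heven b' hjn]; exact Submodule.mem_top)) hu
    · exact BettiUniverse.ofRatClass_crossMap_mem_algebraicClasses_of_finrank_eq_zero hY hZ hij' (Or.inr (hodd j' hj hjn)) u
  obtain ⟨t, ht, hsum, hact⟩ := BettiUniverse.exists_kunneth_family_corrAction_eq μ hHD hY hZ (hY.tensor_holds hZ) hin hab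
    (BettiUniverse.mem_hodgeClasses_hodge_tensor_of_mem_algebraicClasses hHD hY hZ hγ)
  set inn : ↥(antidiagonal (2 * c)) := ⟨(i, n), HasAntidiagonal.mem_antidiagonal.2 hin⟩ with hinn
  have hothers : ∀ ij ∈ univ.erase inn, ij.1.2 ≠ n := by
    intro ij hij' h
    have hne : ij ≠ inn := (Finset.mem_erase.1 hij').1
    have hsum' : ij.1.1 + ij.1.2 = 2 * c := mem_antidiagonal.1 ij.2
    exact hne (Subtype.ext (Prod.ext (show ij.1.1 = i by omega) h))
  refine ⟨t inn, ht inn, ?_, hact⟩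
  have e : ofRatClass (ComplexPoints (Y ⊗ Z)) (2 * c) (BettiUniverse.crossMap Y Z hin (t inn)) =
      ofRatClass (ComplexPoints (Y ⊗ Z)) (2 * c) γ - ∑ ij ∈ univ.erase inn, ofRatClass (ComplexPoints (Y ⊗ Z)) (2 * c) (BettiUniverse.crossMap Y Z (mem_antidiagonal.1 ij.2) (t ij)) := by
    rw [hsum, map_sum, ← Finset.add_sum_erase univ _ (Finset.mem_univ inn), add_sub_cancel_right]
  rw [e]
  refine Submodule.sub_mem _ hγ (Submodule.sum_mem _ fun ij hij' ↦ ?_)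
  obtain ⟨⟨i', j'⟩, hij2⟩ := ij
  exact hpiece i' j' (mem_antidiagonal.1 hij2) (hothers _ hij') (t ⟨(i', j'), hij2⟩) (ht ⟨(i', j'), hij2⟩)

end Component

/-! ### §4 A piece accounted for by algebraic correspondences is algebraic -/

section Piece

variable [HodgeTensorFacts.{0, 0}]

/-- **The piece `Hᵐ(Y) ⊗ Hʲ(Z)` from algebraic correspondences (left factor off-middle algebraic).**  Under the hypotheses of §3 (left), let `γ_k ∈ H^{2c}(Y × Z;ℚ)`, `k ∈ ι`, have algebraic
complexifications and ℂ-linearly independent actions `Hᵃ(Z;ℂ) → Hᵐ(Y;ℂ)` (`a + 2c = m + 2n`), and let `dim_ℚ Hdgᶜ(HᵐY ⊗ HʲZ) ≤ |ι|`.  Then EVERY Hodge class of the summand `Hᵐ(Y) ⊗ Hʲ(Z)` has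
algebraic cross product: the components `t_k` of the `γ_k` (§3) are `|ι|` independent Hodge classes with algebraic cross products, so they span `Hdgᶜ(HᵐY ⊗ HʲZ)` (Lemma 11.41: of dimension
`dim Hom_HS(HᵐY, HʲZ(c − m))`). [cite: VoisinHodgeI2002, §11.3.3 Thm. 11.38–11.40, Lemma 11.41 and pp. 286–287] [cite: Voisin2025, §3.2.1 (12)–(14), Prop. 3.8 and Cor. 3.9] -/
theorem BettiUniverse.crossMap_mem_algebraicClasses_of_linearIndependent_corrAction_left {ι : Type} [Fintype ι] (μ : OrientationFamily) (hHD : exists_isReal_hodgeModel)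
    (hY : IsSmoothProjective m Y) (hZ : IsSmoothProjective n Z) (hHCY : HodgeConjectureFor m Y) (hHCZ : HodgeConjectureFor n Z)
    (hodd : ∀ k, Odd k → k ≠ m → Module.finrank ℚ (bettiCohomology Y k) = 0) (heven : ∀ p, 2 * p ≠ m → (BettiUniverse.hodge hHD hY (2 * p)).hodgeClasses p = ⊤) {c j a : ℕ}
    (hmj : m + j = 2 * c) (hab : a + 2 * c = m + 2 * n) (γ : ι → bettiCohomology (Y ⊗ Z) (2 * c)) (hγ : ∀ k, ofRatClass (ComplexPoints (Y ⊗ Z)) (2 * c) (γ k) ∈ algebraicClasses (Y ⊗ Z) c)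
    (hind : LinearIndependent ℂ fun k ↦ corrAction μ hY hZ hab (ofRatClass (ComplexPoints (Y ⊗ Z)) (2 * c) (γ k)))
    (hle : Module.finrank ℚ ↥(((BettiUniverse.hodge hHD hY m).tensor (BettiUniverse.hodge hHD hZ j)).hodgeClasses c) ≤ Fintype.card ι) :
    ∀ u ∈ (BettiUniverse.kunnethSummand hHD hY hZ (2 * c) ⟨(m, j), HasAntidiagonal.mem_antidiagonal.2 hmj⟩).hodgeClasses c,
      ofRatClass (ComplexPoints (Y ⊗ Z)) (2 * c) (BettiUniverse.crossMap Y Z hmj u) ∈ algebraicClasses (Y ⊗ Z) c := by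
  classical
  haveI := BettiUniverse.finite hY m
  haveI := BettiUniverse.finite hZ j
  intro u hu
  choose t ht halg hact using fun k ↦ BettiUniverse.exists_kunneth_algebraic_corrAction_eq_left μ hHD hY hZ hHCY hHCZ hodd heven hmj hab (hγ k)
  have hli : LinearIndependent ℚ t := by
    rw [Fintype.linearIndependent_iff]
    intro g hg k
    have h0 := congrArg (fun s ↦ corrAction μ hY hZ hab (ofRatClass (ComplexPoints (Y ⊗ Z)) (2 * c) (BettiUniverse.crossMap Y Z hmj s))) hg
    simp only [map_sum, map_smul, ofRatClass_rat_smul', map_zero] at h0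
    simp_rw [hact] at h0
    have h1 := (Fintype.linearIndependent_iff.1 hind) (fun k ↦ ((g k : ℚ) : ℂ)) h0 k
    exact_mod_cast h1
  set T : Submodule ℚ (bettiCohomology Y m ⊗[ℚ] bettiCohomology Z j) := Submodule.span ℚ (Set.range t) with hT
  have ht' : ∀ k, t k ∈ ((BettiUniverse.hodge hHD hY m).tensor (BettiUniverse.hodge hHD hZ j)).hodgeClasses (c : ℤ) := fun k ↦ ht k
  have hTle : T ≤ ((BettiUniverse.hodge hHD hY m).tensor (BettiUniverse.hodge hHD hZ j)).hodgeClasses (c : ℤ) := Submodule.span_le.2 (Set.range_subset_iff.2 ht')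
  have hTrank : Module.finrank ℚ ↥T = Fintype.card ι := finrank_span_eq_card hli
  have hTeq : T = ((BettiUniverse.hodge hHD hY m).tensor (BettiUniverse.hodge hHD hZ j)).hodgeClasses (c : ℤ) :=
    Submodule.eq_of_le_of_finrank_le hTle (by rw [hTrank]; exact hle)
  have hu' : u ∈ T := by
    rw [hTeq]
    exact hu
  obtain ⟨cf, rfl⟩ := (Submodule.mem_span_range_iff_exists_fun ℚ).1 hu'
  rw [map_sum, map_sum]
  refine Submodule.sum_mem _ fun k _ ↦ ?_
  rw [map_smul, ofRatClass_rat_smul']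
  exact Submodule.smul_mem _ _ (halg k)

/-- With the hypotheses of the previous theorem the bound is an EQUALITY: `dim_ℚ Hdgᶜ(HᵐY ⊗ HʲZ) = |ι|` (§2 gives `≥`). [cite: VoisinHodgeI2002, §11.3.3 Lemma 11.41 and pp. 286–287] -/
theorem BettiUniverse.finrank_hodgeClasses_tensor_eq_card_of_linearIndependent_corrAction {ι : Type} [Fintype ι] (μ : OrientationFamily) (hHD : exists_isReal_hodgeModel)
    (hY : IsSmoothProjective m Y) (hZ : IsSmoothProjective n Z) {c i j a : ℕ} (hij : i + j = 2 * c) (hab : a + 2 * c = i + 2 * n) (γ : ι → bettiCohomology (Y ⊗ Z) (2 * c))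
    (hγ : ∀ k, ofRatClass (ComplexPoints (Y ⊗ Z)) (2 * c) (γ k) ∈ algebraicClasses (Y ⊗ Z) c)
    (hind : LinearIndependent ℂ fun k ↦ corrAction μ hY hZ hab (ofRatClass (ComplexPoints (Y ⊗ Z)) (2 * c) (γ k)))
    (hle : Module.finrank ℚ ↥(((BettiUniverse.hodge hHD hY i).tensor (BettiUniverse.hodge hHD hZ j)).hodgeClasses c) ≤ Fintype.card ι) :
    Module.finrank ℚ ↥(((BettiUniverse.hodge hHD hY i).tensor (BettiUniverse.hodge hHD hZ j)).hodgeClasses c) = Fintype.card ι :=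
  le_antisymm hle (BettiUniverse.card_le_finrank_hodgeClasses_tensor_of_linearIndependent_corrAction_of_mem_algebraicClasses μ hHD hY hZ hij hab γ hγ hind)

/-- **The piece `Hⁱ(Y) ⊗ Hⁿ(Z)` from algebraic correspondences (right factor off-middle algebraic)**: mirror of the left version, the correspondences acting on `Hⁿ(Z;ℂ)`.
[cite: VoisinHodgeI2002, §11.3.3 Thm. 11.38–11.40, Lemma 11.41 and pp. 286–287] [cite: Voisin2025, §3.2.1 (12)–(14), Prop. 3.8 and Cor. 3.9] -/
theorem BettiUniverse.crossMap_mem_algebraicClasses_of_linearIndependent_corrAction_right {ι : Type} [Fintype ι] (μ : OrientationFamily) (hHD : exists_isReal_hodgeModel)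
    (hY : IsSmoothProjective m Y) (hZ : IsSmoothProjective n Z) (hHCY : HodgeConjectureFor m Y) (hHCZ : HodgeConjectureFor n Z)
    (hodd : ∀ k, Odd k → k ≠ n → Module.finrank ℚ (bettiCohomology Z k) = 0) (heven : ∀ p, 2 * p ≠ n → (BettiUniverse.hodge hHD hZ (2 * p)).hodgeClasses p = ⊤) {c i : ℕ}
    (hin : i + n = 2 * c) (hab : n + 2 * c = i + 2 * n) (γ : ι → bettiCohomology (Y ⊗ Z) (2 * c)) (hγ : ∀ k, ofRatClass (ComplexPoints (Y ⊗ Z)) (2 * c) (γ k) ∈ algebraicClasses (Y ⊗ Z) c)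
    (hind : LinearIndependent ℂ fun k ↦ corrAction μ hY hZ hab (ofRatClass (ComplexPoints (Y ⊗ Z)) (2 * c) (γ k)))
    (hle : Module.finrank ℚ ↥(((BettiUniverse.hodge hHD hY i).tensor (BettiUniverse.hodge hHD hZ n)).hodgeClasses c) ≤ Fintype.card ι) :
    ∀ u ∈ (BettiUniverse.kunnethSummand hHD hY hZ (2 * c) ⟨(i, n), HasAntidiagonal.mem_antidiagonal.2 hin⟩).hodgeClasses c,
      ofRatClass (ComplexPoints (Y ⊗ Z)) (2 * c) (BettiUniverse.crossMap Y Z hin u) ∈ algebraicClasses (Y ⊗ Z) c := by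
  classical
  haveI := BettiUniverse.finite hY i
  haveI := BettiUniverse.finite hZ n
  intro u hu
  choose t ht halg hact using fun k ↦ BettiUniverse.exists_kunneth_algebraic_corrAction_eq_right μ hHD hY hZ hHCY hHCZ hodd heven hin hab (hγ k)
  have hli : LinearIndependent ℚ t := by
    rw [Fintype.linearIndependent_iff]
    intro g hg k
    have h0 := congrArg (fun s ↦ corrAction μ hY hZ hab (ofRatClass (ComplexPoints (Y ⊗ Z)) (2 * c) (BettiUniverse.crossMap Y Z hin s))) hg
    simp only [map_sum, map_smul, ofRatClass_rat_smul', map_zero] at h0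
    simp_rw [hact] at h0
    have h1 := (Fintype.linearIndependent_iff.1 hind) (fun k ↦ ((g k : ℚ) : ℂ)) h0 k
    exact_mod_cast h1
  set T : Submodule ℚ (bettiCohomology Y i ⊗[ℚ] bettiCohomology Z n) := Submodule.span ℚ (Set.range t) with hT
  have ht' : ∀ k, t k ∈ ((BettiUniverse.hodge hHD hY i).tensor (BettiUniverse.hodge hHD hZ n)).hodgeClasses (c : ℤ) := fun k ↦ ht k
  have hTle : T ≤ ((BettiUniverse.hodge hHD hY i).tensor (BettiUniverse.hodge hHD hZ n)).hodgeClasses (c : ℤ) := Submodule.span_le.2 (Set.range_subset_iff.2 ht')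
  have hTrank : Module.finrank ℚ ↥T = Fintype.card ι := finrank_span_eq_card hli
  have hTeq : T = ((BettiUniverse.hodge hHD hY i).tensor (BettiUniverse.hodge hHD hZ n)).hodgeClasses (c : ℤ) :=
    Submodule.eq_of_le_of_finrank_le hTle (by rw [hTrank]; exact hle)
  have hu' : u ∈ T := by
    rw [hTeq]
    exact hu
  obtain ⟨cf, rfl⟩ := (Submodule.mem_span_range_iff_exists_fun ℚ).1 hu'
  rw [map_sum, map_sum]
  refine Submodule.sum_mem _ fun k _ ↦ ?_
  rw [map_smul, ofRatClass_rat_smul']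
  exact Submodule.smul_mem _ _ (halg k)

end Piece

/-! ### §5 Assembly: `HC(Y × Z)` when the pieces of the off-middle factor are accounted for by algebraic correspondences -/

section Assembly

variable [HodgeTensorFacts.{0, 0}]

/-- **`HC(Y × Z)` for `Y` off-middle algebraic whose pieces `Hᵐ(Y) ⊗ Hʲ(Z)` are accounted for by algebraic correspondences.**  Let `Y` (dimension `m`) satisfy `HC(Y)`, `Hᵏ(Y;ℚ) = 0` for odd `k ≠ m`,
`Hdgᵖ(H^{2p}Y) = H^{2p}(Y;ℚ)` for `2p ≠ m`, and `Z` (dimension `n`) satisfy `HC(Z)`.  Suppose that for every `j` with `1 ≤ j ≤ n` and `m + j = 2c` there are finitely many classes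
`γ_1, …, γ_r ∈ H^{2c}(Y × Z;ℚ)` with algebraic complexifications whose actions `H^{2n−j}(Z;ℂ) → Hᵐ(Y;ℂ)` are ℂ-linearly independent and `dim_ℚ Hdgᶜ(HᵐY ⊗ HʲZ) ≤ r`.  Then `HC(Y × Z)`
(§4 for the pieces `(m, j)`; g29-#7 `…_of_offMiddle_algebraic_left` for all the others). [cite: VoisinHodgeI2002, §11.3.3 Thm. 11.38–11.40, Lemma 11.41 and pp. 286–287] [cite: Voisin2025, §3.2.1 (12)–(14), Prop. 3.8 and Cor. 3.9]
[cite: Deligne2000, §1] -/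
theorem BettiUniverse.hodgeConjectureFor_tensor_of_offMiddle_algebraic_left_of_corrAction (μ : OrientationFamily) (hHD : exists_isReal_hodgeModel) (hY : IsSmoothProjective m Y)
    (hZ : IsSmoothProjective n Z) (hYZ : IsSmoothProjective d (Y ⊗ Z)) (hHCY : HodgeConjectureFor m Y) (hHCZ : HodgeConjectureFor n Z)
    (hodd : ∀ k, Odd k → k ≠ m → Module.finrank ℚ (bettiCohomology Y k) = 0) (heven : ∀ p, 2 * p ≠ m → (BettiUniverse.hodge hHD hY (2 * p)).hodgeClasses p = ⊤)
    (hcorr : ∀ (c j a : ℕ) (hmj : m + j = 2 * c) (hab : a + 2 * c = m + 2 * n), 1 ≤ j → j ≤ n →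
      ∃ (r : ℕ) (γ : Fin r → bettiCohomology (Y ⊗ Z) (2 * c)), (∀ k, ofRatClass (ComplexPoints (Y ⊗ Z)) (2 * c) (γ k) ∈ algebraicClasses (Y ⊗ Z) c) ∧
        LinearIndependent ℂ (fun k ↦ corrAction μ hY hZ hab (ofRatClass (ComplexPoints (Y ⊗ Z)) (2 * c) (γ k))) ∧
        Module.finrank ℚ ↥(((BettiUniverse.hodge hHD hY m).tensor (BettiUniverse.hodge hHD hZ j)).hodgeClasses c) ≤ r) :
    HodgeConjectureFor d (Y ⊗ Z) := by
  refine BettiUniverse.hodgeConjectureFor_tensor_of_offMiddle_algebraic_left hHD hY hZ hYZ hHCY hHCZ hodd heven fun c j hmj hj1 hjn t ht ↦ ?_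
  obtain ⟨r, γ, hγ, hind, hle⟩ := hcorr c j (2 * n - j) hmj (by omega) hj1 hjn
  exact BettiUniverse.crossMap_mem_algebraicClasses_of_linearIndependent_corrAction_left μ hHD hY hZ hHCY hHCZ hodd heven hmj (by omega) γ hγ hind (by simpa using hle) t ht

/-- **Mirror: `HC(Y × Z)` for `Z` off-middle algebraic whose pieces `Hⁱ(Y) ⊗ Hⁿ(Z)`, `1 ≤ i ≤ m`, are accounted for by algebraic correspondences acting on `Hⁿ(Z;ℂ)`.**
[cite: VoisinHodgeI2002, §11.3.3 Thm. 11.38–11.40, Lemma 11.41 and pp. 286–287] [cite: Voisin2025, §3.2.1 (12)–(14), Prop. 3.8 and Cor. 3.9] [cite: Deligne2000, §1] -/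
theorem BettiUniverse.hodgeConjectureFor_tensor_of_offMiddle_algebraic_right_of_corrAction (μ : OrientationFamily) (hHD : exists_isReal_hodgeModel) (hY : IsSmoothProjective m Y)
    (hZ : IsSmoothProjective n Z) (hYZ : IsSmoothProjective d (Y ⊗ Z)) (hHCY : HodgeConjectureFor m Y) (hHCZ : HodgeConjectureFor n Z)
    (hodd : ∀ k, Odd k → k ≠ n → Module.finrank ℚ (bettiCohomology Z k) = 0) (heven : ∀ p, 2 * p ≠ n → (BettiUniverse.hodge hHD hZ (2 * p)).hodgeClasses p = ⊤)
    (hcorr : ∀ (c i : ℕ) (hin : i + n = 2 * c) (hab : n + 2 * c = i + 2 * n), 1 ≤ i → i ≤ m →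
      ∃ (r : ℕ) (γ : Fin r → bettiCohomology (Y ⊗ Z) (2 * c)), (∀ k, ofRatClass (ComplexPoints (Y ⊗ Z)) (2 * c) (γ k) ∈ algebraicClasses (Y ⊗ Z) c) ∧
        LinearIndependent ℂ (fun k ↦ corrAction μ hY hZ hab (ofRatClass (ComplexPoints (Y ⊗ Z)) (2 * c) (γ k))) ∧
        Module.finrank ℚ ↥(((BettiUniverse.hodge hHD hY i).tensor (BettiUniverse.hodge hHD hZ n)).hodgeClasses c) ≤ r) :
    HodgeConjectureFor d (Y ⊗ Z) := by
  refine BettiUniverse.hodgeConjectureFor_tensor_of_offMiddle_algebraic_right hHD hY hZ hYZ hHCY hHCZ hodd heven fun c i hin hi1 him t ht ↦ ?_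
  obtain ⟨r, γ, hγ, hind, hle⟩ := hcorr c i hin (by omega) hi1 him
  exact BettiUniverse.crossMap_mem_algebraicClasses_of_linearIndependent_corrAction_right μ hHD hY hZ hHCY hHCZ hodd heven hin (by omega) γ hγ hind (by simpa using hle) t ht

/-- **Both factors off-middle algebraic: the single piece `Hᵐ(Y) ⊗ Hⁿ(Z)`.**  Let `Y` (dimension `m`) and `Z` (dimension `n`) be off-middle algebraic with `HC(Y)`, `HC(Z)`, `m + n = 2c`; let
`γ_k ∈ H^{2c}(Y × Z;ℚ)`, `k ∈ ι`, have algebraic complexifications and ℂ-linearly independent actions `Hⁿ(Z;ℂ) → Hᵐ(Y;ℂ)`, and `dim_ℚ Hdgᶜ(HᵐY ⊗ HⁿZ) ≤ |ι|`.  Then `HC(Y × Z)` (for `m + n` odd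
there is nothing to check: g29-#7 `…_of_offMiddle_algebraic`). [cite: VoisinHodgeI2002, §11.3.3 Thm. 11.38–11.40, Lemma 11.41 and pp. 286–287] [cite: Voisin2025, §3.2.1 (12)–(14), Prop. 3.8 and Cor. 3.9] [cite: Deligne2000, §1] -/
theorem BettiUniverse.hodgeConjectureFor_tensor_of_offMiddle_algebraic_of_linearIndependent_corrAction {ι : Type} [Fintype ι] (μ : OrientationFamily) (hHD : exists_isReal_hodgeModel)
    (hY : IsSmoothProjective m Y) (hZ : IsSmoothProjective n Z) (hYZ : IsSmoothProjective d (Y ⊗ Z)) (hHCY : HodgeConjectureFor m Y) (hHCZ : HodgeConjectureFor n Z)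
    (hoddY : ∀ k, Odd k → k ≠ m → Module.finrank ℚ (bettiCohomology Y k) = 0) (hevenY : ∀ p, 2 * p ≠ m → (BettiUniverse.hodge hHD hY (2 * p)).hodgeClasses p = ⊤)
    (hoddZ : ∀ k, Odd k → k ≠ n → Module.finrank ℚ (bettiCohomology Z k) = 0) (hevenZ : ∀ p, 2 * p ≠ n → (BettiUniverse.hodge hHD hZ (2 * p)).hodgeClasses p = ⊤)
    {c : ℕ} (hmn : m + n = 2 * c) (hab : n + 2 * c = m + 2 * n) (γ : ι → bettiCohomology (Y ⊗ Z) (2 * c))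
    (hγ : ∀ k, ofRatClass (ComplexPoints (Y ⊗ Z)) (2 * c) (γ k) ∈ algebraicClasses (Y ⊗ Z) c)
    (hind : LinearIndependent ℂ fun k ↦ corrAction μ hY hZ hab (ofRatClass (ComplexPoints (Y ⊗ Z)) (2 * c) (γ k)))
    (hle : Module.finrank ℚ ↥(((BettiUniverse.hodge hHD hY m).tensor (BettiUniverse.hodge hHD hZ n)).hodgeClasses c) ≤ Fintype.card ι) : HodgeConjectureFor d (Y ⊗ Z) := by
  refine BettiUniverse.hodgeConjectureFor_tensor_of_offMiddle_algebraic hHD hY hZ hYZ hHCY hHCZ hoddY hevenY hoddZ hevenZ fun c' hc' t ht ↦ ?_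
  obtain rfl : c' = c := by omega
  exact BettiUniverse.crossMap_mem_algebraicClasses_of_linearIndependent_corrAction_left μ hHD hY hZ hHCY hHCZ hoddY hevenY hmn hab γ hγ hind hle t ht

omit [HodgeTensorFacts.{0, 0}] in
/-- **Hom form** of the previous theorem: `dim_ℚ Hom_HS(Hᵐ(Y), Hⁿ(Z)(c − m)) ≤ |ι|` (Lemma 11.41). [cite: VoisinHodgeI2002, §11.3.3 Thm. 11.40, Lemma 11.41 and pp. 286–287] [cite: Deligne2000, §1] -/
theorem BettiUniverse.hodgeConjectureFor_tensor_of_offMiddle_algebraic_of_linearIndependent_corrAction_of_finrank_hom_le {ι : Type} [Fintype ι] (μ : OrientationFamily)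
    (hHD : exists_isReal_hodgeModel) (hY : IsSmoothProjective m Y) (hZ : IsSmoothProjective n Z) (hYZ : IsSmoothProjective d (Y ⊗ Z)) (hHCY : HodgeConjectureFor m Y) (hHCZ : HodgeConjectureFor n Z)
    (hoddY : ∀ k, Odd k → k ≠ m → Module.finrank ℚ (bettiCohomology Y k) = 0) (hevenY : ∀ p, 2 * p ≠ m → (BettiUniverse.hodge hHD hY (2 * p)).hodgeClasses p = ⊤)
    (hoddZ : ∀ k, Odd k → k ≠ n → Module.finrank ℚ (bettiCohomology Z k) = 0) (hevenZ : ∀ p, 2 * p ≠ n → (BettiUniverse.hodge hHD hZ (2 * p)).hodgeClasses p = ⊤)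
    {c : ℕ} (hmn : m + n = 2 * c) (hab : n + 2 * c = m + 2 * n) (hs : (n : ℤ) - 2 * ((c : ℤ) - m) = m) (γ : ι → bettiCohomology (Y ⊗ Z) (2 * c))
    (hγ : ∀ k, ofRatClass (ComplexPoints (Y ⊗ Z)) (2 * c) (γ k) ∈ algebraicClasses (Y ⊗ Z) c)
    (hind : LinearIndependent ℂ fun k ↦ corrAction μ hY hZ hab (ofRatClass (ComplexPoints (Y ⊗ Z)) (2 * c) (γ k)))
    (hHom : Module.finrank ℚ (HodgeStructure.Hom (BettiUniverse.hodge hHD hY m) (((BettiUniverse.hodge hHD hZ n).tateTwist ((c : ℤ) - m)).cast hs)) ≤ Fintype.card ι) :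
    HodgeConjectureFor d (Y ⊗ Z) := by
  haveI : HodgeTensorFacts.{0, 0} := hodgeTensorFacts_holds
  have e := BettiUniverse.finrank_hodgeClasses_tensor_hodge_eq_finrank_hom_tateTwist hHD hY hZ m n (s := (c : ℤ) - m) hs
  rw [show ((m : ℕ) : ℤ) + ((c : ℤ) - m) = (c : ℤ) by ring] at e
  exact BettiUniverse.hodgeConjectureFor_tensor_of_offMiddle_algebraic_of_linearIndependent_corrAction μ hHD hY hZ hYZ hHCY hHCZ hoddY hevenY hoddZ hevenZ hmn hab γ hγ hind (by rw [e]; exact hHom)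

end Assembly

end Literature.AlgebraicGeometry.HodgeTheory

/-! ### §6 Pairs of smooth hypersurfaces -/

namespace Literature.AlgebraicGeometry.Motives.IsSmoothHypersurface

open Literature.AlgebraicGeometry.Motives
open Literature.AlgebraicGeometry.HodgeTheory

variable {m n e e' : ℕ} {Y Y' : SchemeOver ℂ}

/-- **`HC(Y × Y')` for two smooth hypersurfaces of ODD dimensions `m`, `n` whose piece `Hᵐ(Y) ⊗ Hⁿ(Y')` is accounted for by algebraic correspondences**: `m + n = 2c`, `|ι|` classes
`γ_k ∈ H^{2c}(Y × Y';ℚ)` with algebraic complexifications and ℂ-linearly independent actions `Hⁿ(Y';ℂ) → Hᵐ(Y;ℂ)`, and `dim_ℚ Hom_HS(HᵐY, HⁿY'(c − m)) ≤ |ι|` ⇒ `HC(Y × Y')` — hypersurfaces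
are off-middle algebraic with `HC` in odd dimension (Cor. 1.24/1.25, g29-#7). [cite: VoisinHodgeII2003, §1.2.3 Cor. 1.24 and Cor. 1.25] [cite: VoisinHodgeI2002, §11.3.3 Lemma 11.41 and pp. 286–287] [cite: Fulton1998, §16.1 Def. 16.1.2] -/
theorem hodgeConjectureFor_tensor_hypersurface_of_odd_of_linearIndependent_corrAction {ι : Type} [Fintype ι] (hY : IsSmoothHypersurface m e Y) (hY' : IsSmoothHypersurface n e' Y')
    (μ : OrientationFamily) (hHD : exists_isReal_hodgeModel) (hm : Odd m) (hn : Odd n) {c : ℕ} (hmn : m + n = 2 * c) (hab : n + 2 * c = m + 2 * n) (hs : (n : ℤ) - 2 * ((c : ℤ) - m) = m)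
    (γ : ι → bettiCohomology (Y ⊗ Y') (2 * c)) (hγ : ∀ k, ofRatClass (ComplexPoints (Y ⊗ Y')) (2 * c) (γ k) ∈ algebraicClasses (Y ⊗ Y') c)
    (hind : LinearIndependent ℂ fun k ↦ corrAction μ hY.1 hY'.1 hab (ofRatClass (ComplexPoints (Y ⊗ Y')) (2 * c) (γ k)))
    (hHom : Module.finrank ℚ (HodgeStructure.Hom (BettiUniverse.hodge hHD hY.1 m) (((BettiUniverse.hodge hHD hY'.1 n).tateTwist ((c : ℤ) - m)).cast hs)) ≤ Fintype.card ι) :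
    HodgeConjectureFor (m + n) (Y ⊗ Y') :=
  BettiUniverse.hodgeConjectureFor_tensor_of_offMiddle_algebraic_of_linearIndependent_corrAction_of_finrank_hom_le μ hHD hY.1 hY'.1 (hY.1.tensor_holds hY'.1) (hY.hodgeConjectureFor_of_odd hHD hm)
    (hY'.hodgeConjectureFor_of_odd hHD hn) (fun _ hk hkm ↦ hY.finrank_bettiCohomology_eq_zero_of_odd hk hkm) (fun _ hp ↦ hY.hodgeClasses_hodge_eq_top_of_two_mul_ne hHD hY.1 hp)
    (fun _ hk hkn ↦ hY'.finrank_bettiCohomology_eq_zero_of_odd hk hkn) (fun _ hp ↦ hY'.hodgeClasses_hodge_eq_top_of_two_mul_ne hHD hY'.1 hp) hmn hab hs γ hγ hind hHom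

/-- **`HC(Y × Y')` for two smooth hypersurfaces of the same parity satisfying `HC(Y)`, `HC(Y')`** (automatic for odd dimension; quadrics, cubic fourfolds, … in even dimension) whose piece
`Hᵐ(Y) ⊗ Hⁿ(Y')` is accounted for by algebraic correspondences (same hypotheses as the odd case). [cite: VoisinHodgeII2003, §1.2.3 Cor. 1.24 and Cor. 1.25] [cite: VoisinHodgeI2002, §11.3.3 Lemma 11.41 and pp. 286–287]
[cite: Fulton1998, §16.1 Def. 16.1.2] -/
theorem hodgeConjectureFor_tensor_hypersurface_of_hodgeConjectureFor_of_linearIndependent_corrAction {ι : Type} [Fintype ι] (hY : IsSmoothHypersurface m e Y)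
    (hY' : IsSmoothHypersurface n e' Y') (μ : OrientationFamily) (hHD : exists_isReal_hodgeModel) (hHC : HodgeConjectureFor m Y) (hHC' : HodgeConjectureFor n Y') {c : ℕ} (hmn : m + n = 2 * c)
    (hab : n + 2 * c = m + 2 * n) (hs : (n : ℤ) - 2 * ((c : ℤ) - m) = m) (γ : ι → bettiCohomology (Y ⊗ Y') (2 * c))
    (hγ : ∀ k, ofRatClass (ComplexPoints (Y ⊗ Y')) (2 * c) (γ k) ∈ algebraicClasses (Y ⊗ Y') c)
    (hind : LinearIndependent ℂ fun k ↦ corrAction μ hY.1 hY'.1 hab (ofRatClass (ComplexPoints (Y ⊗ Y')) (2 * c) (γ k)))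
    (hHom : Module.finrank ℚ (HodgeStructure.Hom (BettiUniverse.hodge hHD hY.1 m) (((BettiUniverse.hodge hHD hY'.1 n).tateTwist ((c : ℤ) - m)).cast hs)) ≤ Fintype.card ι) :
    HodgeConjectureFor (m + n) (Y ⊗ Y') :=
  BettiUniverse.hodgeConjectureFor_tensor_of_offMiddle_algebraic_of_linearIndependent_corrAction_of_finrank_hom_le μ hHD hY.1 hY'.1 (hY.1.tensor_holds hY'.1) hHC hHC'
    (fun _ hk hkm ↦ hY.finrank_bettiCohomology_eq_zero_of_odd hk hkm) (fun _ hp ↦ hY.hodgeClasses_hodge_eq_top_of_two_mul_ne hHD hY.1 hp)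
    (fun _ hk hkn ↦ hY'.finrank_bettiCohomology_eq_zero_of_odd hk hkn) (fun _ hp ↦ hY'.hodgeClasses_hodge_eq_top_of_two_mul_ne hHD hY'.1 hp) hmn hab hs γ hγ hind hHom

end Literature.AlgebraicGeometry.Motives.IsSmoothHypersurface

end
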